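/-
Copyright (c) 2026 the pub-hodgecm-mathlib formalisation cell (harness21).  Prover seat hodgecm-mathlib-K2Liu-p09 (g6): Track B «K2-LIT»,
hLiu418 = stmt-HodgeConjecture-24832; LEAD F0P6-plan RULING M-158d «A7-val road (σ)», file V8d (the face-shaped form of the (A4″-KR) assembly + the V6 plug).
-/
import Summits.HodgeConjecture.HodgeConjecture.Theorems.K2LiuA7Value                   -- ★ V8c p860054 master `value_eq_const_mul_of_laws` (brings ★ V8a∕V8b, V1∕V1d, V5, V2b∕V2c)
import Summits.HodgeConjecture.HodgeConjecture.Theorems.K2LiuIkedaFunctionalAverage   -- ★ V6a p859904 (K2Liu-p11): the `K′`-average `B̄` and its three laws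
import HarnessLib

/-!
# Crux `HLiu418`, road `K2_Liu`, organ A7-val, file V8d: THE (A4″-KR) FACE SHAPE FROM THE LAWS, AND THE `K′`-AVERAGE PLUG

Cell `hodgecm-mathlib`, crux item hLiu418 = `stmt-HodgeConjecture-24832`; squad K2 ∕ K2Liu; prover K2Liu-p09 (g6), organ lead A7-val.  THEOREMS ONLY; lane
`--supports stmt-HodgeConjecture-24832` (count-neutral helper).  Rank- and model-generic (the CM instance file specialises in one screen).
* §1 **`exists_average`** — THE V6 PLUG: for `G` unimodular locally compact second countable, `P′ ≤ G` closed, `K′ ≤ G` compact open with `G = P′K′`, the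
  linear action `ρ` of `G` on `X = F_v^ι` and a functional `B : 𝒮(X) →ₗ (H → ℂ)` with continuous coefficients obeying the `(P′, Δ_{P′})`-law, the `K′`-average
  `B̄ Φ h = ∫_{K′} B(ρ(k)Φ) h dk` of ★ V6a is a linear map with the THREE properties the master theorem 📤 V8c eats (`hBbar_fix` with `cK = μ_{K′}(K′) ≠ 0`,
  `hBbar_G`, `hBbar_law`) — ★ V6a `exists_linearMap_average ∕ average_eq_of_forall_fixed ∕ average_mul_eq_average ∕ average_law ∕ measureReal_univ_pos`.
* §2 **`face_of_laws`** — THE FACE SHAPE: under the laws of 📤 V8c with the value map ELIMINATED (★ V8a `exists_valueMap`) and the V7 witness in family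
  currency, `∃ cv ≠ 0, ∀ Φ` `K′`-invariant, `∀ h f`, `f` a `K₀`-flat family of smooth Siegel sections through `𝒜 Φ` ⇒ `∃ Fn : ℂ → ℂ`, `q_v`-rational and regular at
  `½`, `M_v(s)(f s) h = aNorm(s) · Fn s` on `1 < re s`, and **`Fn(½) = cv · B Φ h`** — literally the body of `FaceA4doublePrimeKR` (p03 scratch e56f811bc64cfc2c,
  `K′ : Subgroup`) once `𝒜 = f^Δ` and `B = f^{Δ,S} ∘ r_v` are plugged (★ β-1∕β-2 at the instance of record).
HONEST LABEL.  `HC_CM` is proved only modulo the 7 printed citations (2 remaining named inputs: hLiu418 = `stmt-HodgeConjecture-24832`,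
h413 = `stmt-HodgeConjecture-24833`) until rung 0 closes.

## References
* [KudlaSweet1997] S. Kudla, W. J. Sweet, Israel J. Math. 98 (1997), §1, Thm. 1.2.
* [GanQiuTakeda2014] W. T. Gan, Y. Qiu, S. Takeda, Invent. Math. 198 (2014), §2.7–2.8, §5.5 Prop. 11.
* [Bump1997] D. Bump, Automorphic Forms and Representations, CUP 1997, Prop. 2.1.5, §2.6 (averaging over a compact open subgroup).
-/

set_option autoImplicit false
set_option linter.dupNamespace false -- the mandated namespace repeats `HodgeConjecture.HodgeConjecture`

noncomputable section

open scoped Classical NNReal ENNReal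
open NumberField IsDedekindDomain MeasureTheory MeasureTheory.Measure Topology Set
open Literature.NumberTheory.GaloisRepresentations Literature.NumberTheory.GaloisRepresentations.IsNonarchimedeanLocalField
open Literature.NumberTheory.Automorphic Literature.NumberTheory.Automorphic.UnitaryGroup
open Literature.NumberTheory.GelbartRogawski1991.UnitaryDualPair.LocalSplitting
open Literature.NumberTheory.K2Lit.LocalSiegelDoubled
open Literature.RepresentationTheory.HeisenbergGroup
open Summit.HodgeConjecture.HodgeConjecture.Cruxes.HLiu418.K2LiuQRationalDefs
open Summit.HodgeConjecture.HodgeConjecture.Cruxes.HLiu418.K2LiuLocalLFactorDefs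
open Summit.HodgeConjecture.HodgeConjecture.Cruxes.HLiu418.K2LiuLocalSiegel
open Summit.HodgeConjecture.HodgeConjecture.Cruxes.HLiu418.K2LiuLocalIntertwiningProperty
open Summit.HodgeConjecture.HodgeConjecture.Cruxes.HLiu418.K2LiuA7ValueMap
open Summit.HodgeConjecture.HodgeConjecture.Cruxes.HLiu418.K2LiuA7Value
open Summit.HodgeConjecture.HodgeConjecture.Cruxes.HLiu418.K2LiuIkedaFunctionalAverage

namespace Summit.HodgeConjecture.HodgeConjecture.Cruxes.HLiu418.K2LiuA7ValueFace

universe u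

/-! ## §1 The `K′`-average plug (V6) -/

section Average

variable {𝕜 : Type} [Field 𝕜] [TopologicalSpace 𝕜] {ιX : Type} {H : Type}
  {G : Type u} [Group G] [TopologicalSpace G] [IsTopologicalGroup G] [LocallyCompactSpace G] [T2Space G] [SecondCountableTopology G]
  [MeasurableSpace G] [BorelSpace G]

/-- **THE V6 PLUG.**  The `K′`-average `B̄ Φ h := ∫_{K′} B(leviEquivSB (ρ k) Φ) h dμ_{K′}` (★ V6a) of a functional `B : 𝒮(X) →ₗ (H → ℂ)` with continuous
coefficients and the `(P′, Δ_{P′})`-law is linear, equals `μ_{K′}(K′) · B` on `K′`-invariants (`μ_{K′}(K′) ≠ 0`), is `ρ(G)`-invariant (`G = P′ K′` unimodular),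
and transports every law of `B` through operators commuting with `ρ(K′)`. [cite: Bump1997, Prop. 2.1.5] [cite: GanQiuTakeda2014, §2.7–2.8] -/
theorem exists_average (ρ : G →* ((ιX → 𝕜) ≃ₗ[𝕜] (ιX → 𝕜))) (hρc : ∀ g, Continuous (ρ g)) (hρc' : ∀ g, Continuous (ρ g).symm)
    (P' : Subgroup G) (hP' : IsClosed (P' : Set G)) [LocallyCompactSpace ↥P'] (K' : Subgroup G) (hK' : IsCompact (K' : Set G) ∧ IsOpen (K' : Set G))
    (hIw : ∀ g : G, ∃ p ∈ P', ∃ k ∈ K', g = p * k) (μG : Measure G) [μG.IsHaarMeasure] [μG.IsMulRightInvariant]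
    (μP : Measure ↥P') [μP.IsHaarMeasure] (μK : Measure ↥K') [μK.IsHaarMeasure]
    (B : SchwartzBruhat (ιX → 𝕜) →ₗ[ℂ] (H → ℂ))
    (hBP : ∀ (p : ↥P') (Φ : SchwartzBruhat (ιX → 𝕜)) (h : H),
      B (leviEquivSB (ρ (p : G)) (hρc _) (hρc' _) Φ) h = (((modularCharacter p : ℝ≥0) : ℝ) : ℂ) * B Φ h)
    (hBcont : ∀ (Φ : SchwartzBruhat (ιX → 𝕜)) (h : H), Continuous fun x : G => B (leviEquivSB (ρ x) (hρc x) (hρc' x) Φ) h) :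
    ∃ (Bbar : SchwartzBruhat (ιX → 𝕜) →ₗ[ℂ] (H → ℂ)) (cK : ℂ), cK ≠ 0 ∧
      (∀ Φ : SchwartzBruhat (ιX → 𝕜), (∀ k ∈ K', leviOp (ρ k) (Φ : (ιX → 𝕜) → ℂ) = Φ) → ∀ h, Bbar Φ h = cK * B Φ h) ∧
      (∀ (g : G) (Φ : SchwartzBruhat (ιX → 𝕜)) (h : H), Bbar (leviEquivSB (ρ g) (hρc g) (hρc' g) Φ) h = Bbar Φ h) ∧
      (∀ A : SchwartzBruhat (ιX → 𝕜) →ₗ[ℂ] SchwartzBruhat (ιX → 𝕜),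
        (∀ k ∈ K', ∀ Φ, A (leviEquivSB (ρ k) (hρc k) (hρc' k) Φ) = leviEquivSB (ρ k) (hρc k) (hρc' k) (A Φ)) →
        ∀ (h h' : H) (a : ℂ), (∀ Ψ, B (A Ψ) h = a * B Ψ h') → ∀ Φ, Bbar (A Φ) h = a * Bbar Φ h') := by
  -- `ρ` read on `𝒮(X)` as a homomorphism
  let ω : G →* (SchwartzBruhat (ιX → 𝕜) →ₗ[ℂ] SchwartzBruhat (ιX → 𝕜)) :=
    { toFun := fun g => (leviEquivSB (ρ g) (hρc g) (hρc' g)).toLinearMap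
      map_one' := by
        apply LinearMap.ext; intro Φ; apply Subtype.ext
        rw [LinearEquiv.coe_coe, coe_leviEquivSB, map_one, leviOp_one]; rfl
      map_mul' := fun a b => by
        apply LinearMap.ext; intro Φ; apply Subtype.ext
        simp only [LinearEquiv.coe_coe, coe_leviEquivSB, Module.End.mul_apply]
        rw [map_mul, leviOp_mul, LinearEquiv.mul_apply] }
  have hω : ∀ (g : G) (Φ : SchwartzBruhat (ιX → 𝕜)), ω g Φ = leviEquivSB (ρ g) (hρc g) (hρc' g) Φ := fun _ _ => rfl
  have hint : ∀ (Φ : SchwartzBruhat (ιX → 𝕜)) (h : H), Integrable (fun k : ↥K' => B (ω (k : G) Φ) h) μK := fun Φ h =>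
    integrable_coeff_of_continuous hK'.1 μK ω B Φ h (hBcont Φ h)
  obtain ⟨Bbar, hBbar⟩ := exists_linearMap_average μK ω B hint
  refine ⟨Bbar, (μK.real univ : ℂ), ?_, fun Φ hfix h => ?_, fun g Φ h => ?_, fun A hA h h' a hlaw Φ => ?_⟩
  · exact_mod_cast (measureReal_univ_pos hK'.1 μK).ne'
  · rw [hBbar]
    exact average_eq_of_forall_fixed μK ω B (fun k => Subtype.ext (by rw [hω, coe_leviEquivSB]; exact hfix k k.2)) h
  · rw [hBbar, hBbar, ← hω]
    exact average_mul_eq_average hP' hK'.1 hK'.2 hIw μG μP μK ω B h (fun p Ψ => hBP p Ψ h) Φ (hBcont Φ h) g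
  · rw [hBbar, hBbar]
    exact average_law μK ω B A (fun k Ψ => hA k k.2 Ψ) hlaw Φ

end Average

/-! ## §2 The face shape from the laws -/

section Face

variable (F : Type) [Field F] [NumberField F] (E : Type) [Field E] [NumberField E] [Algebra F E]
  [Algebra.IsQuadraticExtension F E] (c : E ≃ₐ[F] E)
  {δ : E} (hcδ : c δ = -δ) (hδ : δ ≠ 0) {d : F} (hd : δ * δ = algebraMap F E d) (v : HeightOneSpectrum (𝓞 F)) (n : ℕ)
  {T₀ : Matrix (Fin n) (Fin n) F} (hT₀ : T₀.IsSymm) {JD : Matrix (Fin (n + n)) (Fin (n + n)) E} (hJD : JD = (gramD F n T₀).map (algebraMap F E))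
  (χv : ∀ w : PlacesOver E v, (w.1.adicCompletion E)ˣ →* ℂˣ) (χv' : ∀ w : PlacesOver E v, (w.1.adicCompletion E)ˣ →* ℂˣ)
  [MeasurableSpace (unipDeltaLocal F E c v n (JD := JD))] [BorelSpace (unipDeltaLocal F E c v n (JD := JD))]
  (νN : Measure (unipDeltaLocal F E c v n (JD := JD))) [νN.IsMulLeftInvariant] (vol : ℝ)
  (haN : ∀ s : ℂ, 1 < s.re → aNorm F E c v n χv vol s ≠ 0)
  (K₀ : Subgroup (UnitaryGroup.localPi E c (n + n) JD v))
  (hK₀ : IsCompact (K₀ : Set (UnitaryGroup.localPi E c (n + n) JD v)) ∧ IsOpen (K₀ : Set (UnitaryGroup.localPi E c (n + n) JD v)))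
  (hIw : ∀ x : UnitaryGroup.localPi E c (n + n) JD v, ∃ p, IsSiegelDelta F E c hcδ hδ hd v n hT₀ hJD p ∧ ∃ k ∈ K₀, x = p * k)
  (hA4R : ∀ f' : ℂ → UnitaryGroup.localPi E c (n + n) JD v → ℂ, (∀ s, IsLocalSiegelSection F E c hcδ hδ hd v n hT₀ hJD χv s (f' s)) →
    (∀ s, IsSmooth F E c v n (f' s)) → (∀ s s' : ℂ, ∀ k ∈ K₀, f' s k = f' s' k) →
    ∃ Fn' : ℂ → UnitaryGroup.localPi E c (n + n) JD v → ℂ, (∀ h, IsQRationalRegularAt (residueFieldCard (v.adicCompletion F)) (1 / 2) fun s => Fn' s h) ∧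
      ∀ s : ℂ, 1 < s.re → ∀ h, localIntertwining F E c v n hJD νN (f' s) h = aNorm F E c v n χv vol s * Fn' s h)
  (hintA : ∀ f' : ℂ → UnitaryGroup.localPi E c (n + n) JD v → ℂ, (∀ s, IsLocalSiegelSection F E c hcδ hδ hd v n hT₀ hJD χv s (f' s)) →
    (∀ s, IsSmooth F E c v n (f' s)) → (∀ s s' : ℂ, ∀ k ∈ K₀, f' s k = f' s' k) → ∀ s : ℂ, 1 < s.re → ∀ h,
      Integrable (fun u : unipDeltaLocal F E c v n (JD := JD) => f' s (weylDelta F E c v n hJD * (u : UnitaryGroup.localPi E c (n + n) JD v) * h)) νN)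
  (hmod : ∀ (q' : UnitaryGroup.localPi E c (n + n) JD v) (hq : IsSiegelDelta F E c hcδ hδ hd v n hT₀ hJD q'),
    Measure.map (fun u : unipDeltaLocal F E c v n (JD := JD) =>
      (⟨q' * (u : UnitaryGroup.localPi E c (n + n) JD v) * q'⁻¹, conj_mem_unipDeltaLocal F E c hcδ hδ hd v n hT₀ hJD hq u.2⟩ :
        unipDeltaLocal F E c v n (JD := JD))) νN =
      ENNReal.ofReal ((absDetDelta F E c v n q' ^ n)⁻¹) • νN)
  (hχ' : ∀ (w w' : PlacesOver E v) (h : c • w.1 = w'.1),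
    χv' w = (χv w')⁻¹.comp (Units.map (galAdicCompletionMap (L := E) c h : w.1.adicCompletion E →* w'.1.adicCompletion E)))
  (hT₀d : IsUnit T₀.det)
  {ιX : Type} [Fintype ιX]
  (ω : UnitaryGroup.localPi E c (n + n) JD v → SchwartzBruhat (ιX → v.adicCompletion F) →ₗ[ℂ] SchwartzBruhat (ιX → v.adicCompletion F))
  (𝒜 : SchwartzBruhat (ιX → v.adicCompletion F) →ₗ[ℂ] ↥(localDegPS F E c hcδ hδ hd v n hT₀ hJD χv (1 / 2)))
  (h𝒜 : ∀ (u : UnitaryGroup.localPi E c (n + n) JD v) (Φ : SchwartzBruhat (ιX → v.adicCompletion F)) (x : UnitaryGroup.localPi E c (n + n) JD v),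
    ((𝒜 (ω u Φ) : ↥(localDegPS F E c hcδ hδ hd v n hT₀ hJD χv (1 / 2))) : UnitaryGroup.localPi E c (n + n) JD v → ℂ) x =
      ((𝒜 Φ : ↥(localDegPS F E c hcδ hδ hd v n hT₀ hJD χv (1 / 2))) : UnitaryGroup.localPi E c (n + n) JD v → ℂ) (x * u))
  (B : SchwartzBruhat (ιX → v.adicCompletion F) →ₗ[ℂ] (UnitaryGroup.localPi E c (n + n) JD v → ℂ))
  (hB : ∀ (u : UnitaryGroup.localPi E c (n + n) JD v) (Φ : SchwartzBruhat (ιX → v.adicCompletion F)) (h : UnitaryGroup.localPi E c (n + n) JD v),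
    B (ω u Φ) h = B Φ (h * u))
  (hSiegS : ∀ Φ : SchwartzBruhat (ιX → v.adicCompletion F), IsLocalSiegelSection F E c hcδ hδ hd v n hT₀ hJD χv' (-(1 / 2)) (B Φ))
  {G : Type} [Group G] [TopologicalSpace G] [IsTopologicalGroup G] [TotallyDisconnectedSpace G] [SigmaCompactSpace G]
  (ρ : G →* ((ιX → v.adicCompletion F) ≃ₗ[v.adicCompletion F] (ιX → v.adicCompletion F)))
  (hρc : ∀ g, Continuous (ρ g)) (hρc' : ∀ g, Continuous (ρ g).symm)
  (h𝒜G : ∀ (g : G) (Φ : SchwartzBruhat (ιX → v.adicCompletion F)) (x : UnitaryGroup.localPi E c (n + n) JD v),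
    ((𝒜 (leviEquivSB (ρ g) (hρc g) (hρc' g) Φ) : ↥(localDegPS F E c hcδ hδ hd v n hT₀ hJD χv (1 / 2))) : UnitaryGroup.localPi E c (n + n) JD v → ℂ) x =
      ((𝒜 Φ : ↥(localDegPS F E c hcδ hδ hd v n hT₀ hJD χv (1 / 2))) : UnitaryGroup.localPi E c (n + n) JD v → ℂ) x)
  (hωG : ∀ (u : UnitaryGroup.localPi E c (n + n) JD v) (g : G) (Φ : SchwartzBruhat (ιX → v.adicCompletion F)),
    ω u (leviEquivSB (ρ g) (hρc g) (hρc' g) Φ) = leviEquivSB (ρ g) (hρc g) (hρc' g) (ω u Φ))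
  (K' : Subgroup G) (hK' : IsCompact (K' : Set G) ∧ IsOpen (K' : Set G))
  (Bbar : SchwartzBruhat (ιX → v.adicCompletion F) →ₗ[ℂ] (UnitaryGroup.localPi E c (n + n) JD v → ℂ)) {cK : ℂ} (hcK : cK ≠ 0)
  (hBbar_fix : ∀ Φ : SchwartzBruhat (ιX → v.adicCompletion F),
    (∀ k ∈ K', leviOp (ρ k) (Φ : (ιX → v.adicCompletion F) → ℂ) = Φ) → ∀ h, Bbar Φ h = cK * B Φ h)
  (hBbar_G : ∀ (g : G) (Φ : SchwartzBruhat (ιX → v.adicCompletion F)) (h : UnitaryGroup.localPi E c (n + n) JD v),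
    Bbar (leviEquivSB (ρ g) (hρc g) (hρc' g) Φ) h = Bbar Φ h)
  (hBbar_law : ∀ A : SchwartzBruhat (ιX → v.adicCompletion F) →ₗ[ℂ] SchwartzBruhat (ιX → v.adicCompletion F),
    (∀ k ∈ K', ∀ Φ, A (leviEquivSB (ρ k) (hρc k) (hρc' k) Φ) = leviEquivSB (ρ k) (hρc k) (hρc' k) (A Φ)) →
    ∀ (h h' : UnitaryGroup.localPi E c (n + n) JD v) (a : ℂ), (∀ Ψ, B (A Ψ) h = a * B Ψ h') → ∀ Φ, Bbar (A Φ) h = a * Bbar Φ h')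
  {Γ₁ : Type} [Group Γ₁] [TopologicalSpace Γ₁] [IsTopologicalGroup Γ₁] [TotallyDisconnectedSpace Γ₁] [SigmaCompactSpace Γ₁]
  (mΔ : Γ₁ →* UnitaryGroup.localPi E c (n + n) JD v) (hmΔ : ∀ a, IsSiegelDelta F E c hcδ hδ hd v n hT₀ hJD (mΔ a))
  (aX : Γ₁ →* ((ιX → v.adicCompletion F) ≃ₗ[v.adicCompletion F] (ιX → v.adicCompletion F)))
  (haXc : ∀ a, Continuous (aX a)) (haXc' : ∀ a, Continuous (aX a).symm)
  (cM : Γ₁ →* ℂˣ)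
  (hM : ∀ (a : Γ₁) (Φ : SchwartzBruhat (ιX → v.adicCompletion F)), ω (mΔ a) Φ = (cM a : ℂ) • leviEquivSB (aX a) (haXc a) (haXc' a) Φ)
  (haXρ : ∀ (a : Γ₁) (g : G), Commute (aX a) (ρ g))
  (hcont : Continuous fun p : (Γ₁ × G) × (ιX → v.adicCompletion F) => aX p.1.1 (ρ p.1.2 p.2))
  (K₁ : Subgroup Γ₁) (hK₁ : IsCompact (K₁ : Set Γ₁) ∧ IsOpen (K₁ : Set Γ₁))
  (hK₁χ : ∀ a ∈ K₁, (cM a : ℂ) = localSiegelCharacter F E c v n χv' (-(1 / 2)) (mΔ a))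
  (a₀ : Γ₁) (ha₀ : (cM a₀ : ℂ) ≠ localSiegelCharacter F E c v n χv' (-(1 / 2)) (mΔ a₀))
  {ι : Type} [Fintype ι] (nΔ : (ι → v.adicCompletion F) → UnitaryGroup.localPi E c (n + n) JD v)
  (hnΔ : ∀ η, nΔ η ∈ unipDeltaLocal F E c v n (JD := JD)) (q : (ιX → v.adicCompletion F) → ι → v.adicCompletion F) (hq : Continuous q)
  (ψ : AddChar (v.adicCompletion F) Circle) {m : ℤ} (hm : ψ.HasConductorExp m)
  (hN : ∀ (η : ι → v.adicCompletion F) (Φ : SchwartzBruhat (ιX → v.adicCompletion F)) (x : ιX → v.adicCompletion F),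
    ((ω (nΔ η) Φ : SchwartzBruhat (ιX → v.adicCompletion F)) : (ιX → v.adicCompletion F) → ℂ) x =
      ((ψ (η ⬝ᵥ q x) : Circle) : ℂ) * (Φ : (ιX → v.adicCompletion F) → ℂ) x)
  (hNρ : ∀ (g : G) (x : ιX → v.adicCompletion F), q x = 0 → q (ρ g x) = 0)
  (hNa : ∀ (a : Γ₁) (x : ιX → v.adicCompletion F), q x = 0 → q (aX a x) = 0)
  (htrans : ∀ x y : ιX → v.adicCompletion F, q x = 0 → q y = 0 → x ≠ 0 → y ≠ 0 → ∃ (a : Γ₁) (g : G), aX a (ρ g x) = y)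
  -- the witnesses: V7 in FAMILY currency (a `K₀`-flat family through `𝒜 Φ₀` whose value at `1` is non-zero), V6 (iv)
  (hne : ∃ (Φ₀ : SchwartzBruhat (ιX → v.adicCompletion F)) (f Fn : ℂ → UnitaryGroup.localPi E c (n + n) JD v → ℂ),
    (∀ s, IsLocalSiegelSection F E c hcδ hδ hd v n hT₀ hJD χv s (f s)) ∧ (∀ s, IsSmooth F E c v n (f s)) ∧ (∀ s s' : ℂ, ∀ k ∈ K₀, f s k = f s' k) ∧
    f (1 / 2) = ((𝒜 Φ₀ : ↥(localDegPS F E c hcδ hδ hd v n hT₀ hJD χv (1 / 2))) : UnitaryGroup.localPi E c (n + n) JD v → ℂ) ∧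
    (∀ h, IsQRationalRegularAt (residueFieldCard (v.adicCompletion F)) (1 / 2) fun s => Fn s h) ∧
    (∀ s : ℂ, 1 < s.re → ∀ h, localIntertwining F E c v n hJD νN (f s) h = aNorm F E c v n χv vol s * Fn s h) ∧ Fn (1 / 2) 1 ≠ 0)
  (hBne : ∃ Φ₁ : SchwartzBruhat (ιX → v.adicCompletion F), (∀ k ∈ K', leviOp (ρ k) (Φ₁ : (ιX → v.adicCompletion F) → ℂ) = Φ₁) ∧ B Φ₁ 1 ≠ 0)

include hcδ hδ hd hT₀ hJD hK₀ hIw hA4R hintA haN hmod hχ' hT₀d h𝒜 hB hSiegS h𝒜G hωG hK' hcK hBbar_fix hBbar_G hBbar_law hmΔ hM haXρ hcont hK₁ hK₁χ ha₀ hnΔ hq hm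
  hN hNρ hNa htrans hne hBne in
/-- **THE (A4″-KR) FACE FROM THE LAWS** (the body of `FaceA4doublePrimeKR`, scratch e56f811bc64cfc2c, with `𝒜 = f^Δ` and `B = f^{Δ,S} ∘ r_v` abstract and
`K′ : Subgroup`): there is `cv ≠ 0` such that for every `K′`-invariant `Φ`, every `h ∈ H_v` and every `K₀`-flat family `f` of smooth Siegel sections of
`I_v(s, χ_v)` through `𝒜 Φ` there is `Fn : ℂ → ℂ`, rational in `q_v^{−s}` and regular at `½`, with `M_v(s)(f s) h = aNorm(s) · Fn s` on `1 < re s` and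
**`Fn(½) = cv · B Φ h`** (📤 V8c master + ★ V8a `exists_valueMap` + the (A4′-R) datum of `f`). [cite: KudlaSweet1997, §1, Thm. 1.2] [cite: GanQiuTakeda2014, §2.7–2.8] -/
theorem face_of_laws :
    ∃ cv : ℂ, cv ≠ 0 ∧ ∀ Φ : SchwartzBruhat (ιX → v.adicCompletion F),
      (∀ k ∈ K', leviOp (ρ k) (Φ : (ιX → v.adicCompletion F) → ℂ) = Φ) →
      ∀ (h : UnitaryGroup.localPi E c (n + n) JD v) (f : ℂ → UnitaryGroup.localPi E c (n + n) JD v → ℂ),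
        (∀ s, IsLocalSiegelSection F E c hcδ hδ hd v n hT₀ hJD χv s (f s)) → (∀ s, IsSmooth F E c v n (f s)) →
        (∀ s s' : ℂ, ∀ k ∈ K₀, f s k = f s' k) →
        f (1 / 2) = ((𝒜 Φ : ↥(localDegPS F E c hcδ hδ hd v n hT₀ hJD χv (1 / 2))) : UnitaryGroup.localPi E c (n + n) JD v → ℂ) →
        ∃ Fn : ℂ → ℂ, IsQRationalRegularAt (residueFieldCard (v.adicCompletion F)) (1 / 2) Fn ∧
          (∀ s : ℂ, 1 < s.re → localIntertwining F E c v n hJD νN (f s) h = aNorm F E c v n χv vol s * Fn s) ∧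
          Fn (1 / 2) = cv * B Φ h := by
  obtain ⟨ℳ, hℳ⟩ := exists_valueMap F E c hcδ hδ hd v n hT₀ hJD χv νN vol haN K₀ hK₀ hIw hA4R hintA
  have hne' : ∃ Φ₀ : SchwartzBruhat (ιX → v.adicCompletion F), ℳ (𝒜 Φ₀) 1 ≠ 0 := by
    obtain ⟨Φ₀, f, Fn, hS, hsm, hfl, hthr, hreg, hfac, h0⟩ := hne
    exact ⟨Φ₀, by rwa [hℳ (𝒜 Φ₀) f Fn hS hsm hfl hthr hreg hfac 1]⟩
  obtain ⟨cv, hcv, hval⟩ := value_eq_const_mul_of_laws F E c hcδ hδ hd v n hT₀ hJD χv χv' νN vol haN K₀ hK₀ hIw hA4R hintA ℳ hℳ hmod hχ' hT₀d ω 𝒜 h𝒜 B hB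
    hSiegS ρ hρc hρc' h𝒜G hωG K' hK' Bbar hcK hBbar_fix hBbar_G hBbar_law mΔ hmΔ aX haXc haXc' cM hM haXρ hcont K₁ hK₁ hK₁χ a₀ ha₀ nΔ hnΔ q hq ψ hm hN hNρ hNa
    htrans hne' hBne
  refine ⟨cv, hcv, fun Φ hΦK h f hS hsm hfl hthr => ?_⟩
  obtain ⟨Fn', hreg, hfac⟩ := hA4R f hS hsm hfl
  refine ⟨fun s => Fn' s h, hreg h, fun s hs => hfac s hs h, ?_⟩
  show Fn' (1 / 2) h = cv * B Φ h
  rw [← hℳ (𝒜 Φ) f Fn' hS hsm hfl hthr hreg hfac h]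
  exact hval Φ hΦK h

end Face

end Summit.HodgeConjecture.HodgeConjecture.Cruxes.HLiu418.K2LiuA7ValueFace

end
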